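import Summits.QuantumFields.BalabanUV.T4Continuum.Support.NE7InterpolationLiftCurl
import HarnessLib

/-!
# NE7WhitneyLiftFlat — THE WHITNEY-TYPE LIFT OF A COARSE 1-FORM (flat longitudinal profile `1∕M` × the transverse MULTILINEAR interpolant): SHARP `ℓ²` MASS `M^{d−2}`,
# EXACT COMMUTATION WITH THE GAUGE DIRECTIONS AND WITH THE FLAT CURL (`curl_1 (Wφ)(z;μ,ν) = M^{−2} • interp_{univ∖{μ,ν}} (curl_1 φ) (z)`), CURL ENERGY `≤ 2^{d−2}·M^{d−4}·(coarse curl energy)`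
# (lineage `b2b-balaban-t4-ne7b-p1`, gen 162; route (H′) of `t4/b2b-balaban-t4-ne7b-p1/g162/records/SCOPING-LEVELMASSES.md` §3, the lift letters (L1)–(L2))

Cell `pub-balaban`, rung (B)+1 sub-cell t4, lineage `b2b-balaban-t4-ne7b-p1` (row NE7b OWNER + CRUX PROVER; junction service for row NE7 on ROAD-G116 §6 (G3) ∕ ROAD-G117 §4 (S1)),
generation 162.  THE OBJECT (written out in every statement; no `def`): for a coarse 1-form `φ` on the unit lattice and a block side `M`,
  `W φ (z, κ) := (M : ℝ)⁻¹ • interp M (univ ∖ {κ}) (φ(·, κ)) z`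
— the `κ`-component is CONSTANT along `κ` inside each block and is the transverse multilinear interpolant (✓ `SmoothRefineInterp.interp`) of the `2^{d−1}` parallel coarse `κ`-bonds of the cell:
the lowest-order Nédélec ∕ Whitney 1-form of the cubical `M`-refinement.  Contrast: gen 160's ✓ `NE7InterpolationLiftFlat` (row NE3's SIGNED longitudinal profile `lprof` in place of `1∕M`,
exact under the straight LINE average but distorting constants pointwise) and row NE3's in-block bump ✓ `NE3SmoothLiftFlat.smoothLift` (curl `O(φ∕M²)`).
WHAT ([folklore]; 0 def, 0 sorry; every `d`, every real normed space for §1–§2):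
§1 JENSEN FOR THE MULTILINEAR INTERPOLANT: `norm_sq_convex_comb_le`, **`norm_sq_interpCore_le`** (`‖interpCore S G z w‖² ≤ interpCore S (‖G‖²) z w` for weights in `[0,1]`),
   `interpCore_real_le_sum` (`≤ Σ_{T⊆S} g(z + 𝟙_T)` for `g ≥ 0`);
§2 THE SHARP BLOCK SUM: **`sum_norm_sq_interp_le`** — `Σ_{z∈[0,MN)^d} ‖interp M (univ∖{κ}) G z‖² ≤ M^d·Σ_{y∈[0,N)^d} ‖G y‖²` for `N`-periodic `G` (block Fubini ✓ `sum_boxVec_mul_interpCore`, binomial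
   identity ✓ `sum_interpWeight`, periodic corner shifts) — the constant is EXACTLY `M^d` (the transverse weights of the `2^{d−1}` cells sharing a coarse bond add up to `M^{d−1}`);
§3 THE LIFT: `isSkewDir_whitneyLift`, `whitneyLift_add_period`, **`dirSq_whitneyLift_le`** (`dirSq (Wφ) [0,MN)^d ≤ M^d∕M²·dirSq φ [0,N)^d` — (L1) of the memo with constant ONE),
   **`whitneyLift_gaugeDir_flat`** (`W (gaugeDir 1 ν) = gaugeDir 1 (interp M univ ν)` — EXACT: gauge directions lift to gauge directions of the nodal interpolant),
   **`curlAt_flat_whitneyLift`** (`curl_1 (Wφ) (z; μ, ν) = M^{−2} • interp M ((univ∖{μ})∖{ν}) (curl_1 φ (·; μ, ν)) z` — the EXACT Whitney∕de Rham commutation: a curl-free datum lifts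
   curl-free, a constant-curl datum lifts to constant curl), **`sum_norm_sq_curlAt_flat_whitneyLift_le`** (`Σ_{z∈[0,MN)^d} ‖curl_1 (Wφ)(z;μ,ν)‖² ≤ 2^{d−2}·(M^d∕M⁴)·Σ_{y∈[0,N)^d} ‖curl_1 φ (y;μ,ν)‖²`
   — (L2) of the memo: the lift's curl energy is controlled by the COARSE CURL energy alone, scale-correct (`M^{d−4} = 1` at `d = 4`)).
WHAT IS NOT HERE: the defect `T∘W − id` of the full one-step linearised average on the lift (it kills gauge directions and is bounded by the coarse gradient — next file), the curved
(transported) version, exactness (row NE3's ✓ `rightInvW` corrects the defect).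
HONEST FRAMING (page 1): flat lattice kinematics of OUR lift; nothing of Bałaban's asserted ([Balaban1985Averaging] (42), (47)–(48) context only); NOT (G3), NOT (G), NOT NE7∕NE3 as spine nodes;
row NE7b NOT PRINTED ∕ NOT PROVED; spine 0∕9; finite T⁴ rung (B)+1 — NOT infinite volume, NOT mass gap, NOT BetaPertH, NOT Clay.
-/

set_option autoImplicit false

open scoped BigOperators Matrix Matrix.Norms.L2Operator
open Finset

namespace Summit.QuantumFields.BalabanUV.T4Continuum.NE7WhitneyLiftFlat

open Literature.MathematicalPhysics.QuantumFieldTheory.Balaban1983to89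
open B7Prop1Explicit B7Prop2Explicit
open T4AveragingDeficitWall (curlAt IsSkewDir dirSq Ad blockSites)
open T4AveragingDeficitWallBoundary (periodBox mem_periodBox sum_periodBox_shift sum_blocks_eq blockSites_periodBox)
open BlockAveragePushDirGauge (gaugeDir)
open BlockAveragePushDirSplit (flat)
open SmoothRefineBlocks (blk res blk_boxVec res_boxVec)
open SmoothRefineInterp (interp interpCore indic cfd wt wt_nonneg wt_le_one interp_mem interp_add_e_of_mem interp_sub interpCore_insert interpCore_empty)
open NE3SmoothLiftCurl (curlAt_flat_eq)
open NE3CoarseInterpolant (interp_add_period)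
open NE7InterpolationLiftFlat (sum_boxVec_mul_interpCore sum_interpWeight)

noncomputable section

variable {d : ℕ} {n : Type*} [Fintype n] [DecidableEq n]

/-! ## §1 Jensen for the multilinear interpolant -/

section Jensen

variable {X : Type*} [NormedAddCommGroup X] [NormedSpace ℝ X]

omit [Fintype n] [DecidableEq n] in
/-- Convexity of the squared norm: `‖(1−t)a + tb‖² ≤ (1−t)‖a‖² + t‖b‖²` for `t ∈ [0,1]`. [folklore] -/
theorem norm_sq_convex_comb_le (a b : X) {t : ℝ} (ht0 : 0 ≤ t) (ht1 : t ≤ 1) :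
    ‖(1 - t) • a + t • b‖ ^ 2 ≤ (1 - t) * ‖a‖ ^ 2 + t * ‖b‖ ^ 2 := by
  have ht1' : 0 ≤ 1 - t := sub_nonneg.mpr ht1
  have h1 : ‖(1 - t) • a + t • b‖ ≤ (1 - t) * ‖a‖ + t * ‖b‖ := by
    calc ‖(1 - t) • a + t • b‖ ≤ ‖(1 - t) • a‖ + ‖t • b‖ := norm_add_le _ _
      _ = (1 - t) * ‖a‖ + t * ‖b‖ := by rw [norm_smul, norm_smul, Real.norm_of_nonneg ht0, Real.norm_of_nonneg ht1']
  have hA := norm_nonneg a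
  have hB := norm_nonneg b
  calc ‖(1 - t) • a + t • b‖ ^ 2 ≤ ((1 - t) * ‖a‖ + t * ‖b‖) ^ 2 := pow_le_pow_left₀ (norm_nonneg _) h1 2
    _ ≤ (1 - t) * ‖a‖ ^ 2 + t * ‖b‖ ^ 2 := by
        nlinarith [mul_nonneg (mul_nonneg ht0 ht1') (sq_nonneg (‖a‖ - ‖b‖))]

omit [Fintype n] [DecidableEq n] in
/-- **JENSEN FOR THE MULTILINEAR INTERPOLANT**: for weights in `[0,1]`, `‖interpCore S G z w‖² ≤ interpCore S (fun y ↦ ‖G y‖²) z w` — the interpolant is a convex combination of the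
`2^{|S|}` corner values. [folklore] -/
theorem norm_sq_interpCore_le (S : Finset (Fin d)) {w : Fin d → ℝ} (hw0 : ∀ i, 0 ≤ w i) (hw1 : ∀ i, w i ≤ 1) :
    ∀ (G : Site d → X) (z : Site d), ‖interpCore S G z w‖ ^ 2 ≤ interpCore S (fun y => ‖G y‖ ^ 2) z w := by
  induction S using Finset.induction_on with
  | empty => intro G z; simp [interpCore_empty]
  | insert i S hi ih =>
      intro G z
      rw [interpCore_insert hi, interpCore_insert hi]
      refine (norm_sq_convex_comb_le _ _ (hw0 i) (hw1 i)).trans ?_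
      have h1 := ih G z
      have h2 := ih (fun x => G (x + e i)) z
      simp only [smul_eq_mul]
      have ht0 := hw0 i
      have ht1 := sub_nonneg.mpr (hw1 i)
      nlinarith [mul_le_mul_of_nonneg_left h1 ht1, mul_le_mul_of_nonneg_left h2 ht0]

omit [Fintype n] [DecidableEq n] in
/-- The real interpolant of a non-negative function is dominated by the plain corner sum (weights `≤ 1`). [folklore] -/
theorem interpCore_real_le_sum (S : Finset (Fin d)) {w : Fin d → ℝ} (hw0 : ∀ i, 0 ≤ w i) (hw1 : ∀ i, w i ≤ 1)
    {g : Site d → ℝ} (hg : ∀ y, 0 ≤ g y) (z : Site d) :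
    interpCore S g z w ≤ ∑ T ∈ S.powerset, g (z + indic T) := by
  unfold interpCore
  refine Finset.sum_le_sum fun T _ => ?_
  rw [smul_eq_mul]
  have hc1 : (∏ i ∈ T, w i) * ∏ i ∈ S \ T, (1 - w i) ≤ 1 :=
    mul_le_one₀ (Finset.prod_le_one (fun i _ => hw0 i) fun i _ => hw1 i) (Finset.prod_nonneg fun i _ => sub_nonneg.mpr (hw1 i))
      (Finset.prod_le_one (fun i _ => sub_nonneg.mpr (hw1 i)) fun i _ => sub_le_self _ (hw0 i))
  exact mul_le_of_le_one_left (hg _) hc1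

/-! ## §2 The sharp block sum of the transverse interpolant -/

omit [Fintype n] [DecidableEq n] in
/-- **THE SHARP BLOCK SUM**: for an `N`-periodic coarse site function `G` with values in a real normed space and `M, N ≥ 1`,
`Σ_{z∈[0,MN)^d} ‖interp M (univ∖{κ}) G z‖² ≤ M^d · Σ_{y∈[0,N)^d} ‖G y‖²` — Jensen pointwise, block Fubini (✓ `sum_boxVec_mul_interpCore` with the constant profile), the binomial identity
(✓ `sum_interpWeight`) and periodic corner shifts; the constant `M^d` is attained on constants. [folklore] -/
theorem sum_norm_sq_interp_le {M : ℕ} (hM : 1 ≤ M) {N : ℕ} (hN : 1 ≤ N) (κ : Fin d) {G : Site d → X}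
    (hG : ∀ (y : Site d) (τ : Fin d), G (y + (N : ℤ) • e τ) = G y) :
    ∑ z ∈ periodBox (d := d) (M * N), ‖interp M (Finset.univ.erase κ) G z‖ ^ 2 ≤ (M : ℝ) ^ d * ∑ y ∈ periodBox (d := d) N, ‖G y‖ ^ 2 := by
  have hd : 1 ≤ d := Nat.one_le_iff_ne_zero.mpr (by rintro rfl; exact Fin.elim0 κ)
  have hM0 : (M : ℝ) ≠ 0 := by exact_mod_cast (by omega : M ≠ 0)
  set S : Finset (Fin d) := Finset.univ.erase κ with hS
  set g : Site d → ℝ := fun y => ‖G y‖ ^ 2 with hg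
  -- pointwise Jensen
  have hpt : ∀ z : Site d, ‖interp M S G z‖ ^ 2 ≤ interpCore S g (blk M z) (wt M z) :=
    fun z => norm_sq_interpCore_le S (wt_nonneg hM z) (wt_le_one hM z) G (blk M z)
  -- block decomposition of the fine period box
  have hblocks : ∑ z ∈ periodBox (d := d) (M * N), interpCore S g (blk M z) (wt M z)
      = ∑ y ∈ periodBox (d := d) N, ∑ r : Fin d → Fin M, interpCore S g y (fun j => ((r j : ℕ) : ℝ) / M) := by
    rw [← blockSites_periodBox M N hM, ← sum_blocks_eq M hM]
    refine Finset.sum_congr rfl fun y _ => Finset.sum_congr rfl fun r _ => ?_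
    rw [blk_boxVec hM y r]
    congr 1
    funext j
    simp only [wt, res_boxVec hM y r, boxVec]
    push_cast
    rfl
  -- block Fubini with the constant profile
  have hfub : ∀ y : Site d, ∑ r : Fin d → Fin M, interpCore S g y (fun j => ((r j : ℕ) : ℝ) / M)
      = ∑ T ∈ S.powerset, ((M : ℝ) * ((((M : ℝ)) - 1) / 2) ^ T.card * ((((M : ℝ)) + 1) / 2) ^ (S.card - T.card)) * g (y + indic T) := by
    intro y
    have h := sum_boxVec_mul_interpCore (X := ℝ) hM κ (fun _ => (1 : ℝ)) g y
    simp only [Finset.sum_const, Finset.card_univ, Fintype.card_fin, nsmul_eq_mul, mul_one, smul_eq_mul, one_mul] at h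
    rw [← hS] at h
    exact h
  -- periodic corner shifts
  have hshift : ∀ T : Finset (Fin d), ∑ y ∈ periodBox (d := d) N, g (y + indic T) = ∑ y ∈ periodBox (d := d) N, g y :=
    fun T => sum_periodBox_shift N hN (g := g) (fun x τ => by simp only [hg, hG]) (indic T)
  -- the weights add up to `M^d`
  have hcard : S.card = d - 1 := by rw [hS, Finset.card_erase_of_mem (Finset.mem_univ κ), Finset.card_univ, Fintype.card_fin]
  have hweights : ∑ T ∈ S.powerset, (M : ℝ) * ((((M : ℝ)) - 1) / 2) ^ T.card * ((((M : ℝ)) + 1) / 2) ^ (S.card - T.card) = (M : ℝ) ^ d := by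
    have hW := sum_interpWeight (d := d) hM κ
    rw [← hS] at hW
    rw [hcard]
    obtain ⟨d', rfl⟩ : ∃ d', d = d' + 1 := ⟨d - 1, by omega⟩
    simp only [Nat.add_sub_cancel] at hW ⊢
    have hMp : (M : ℝ) ^ d' ≠ 0 := pow_ne_zero _ hM0
    calc ∑ T ∈ S.powerset, (M : ℝ) * ((((M : ℝ)) - 1) / 2) ^ T.card * ((((M : ℝ)) + 1) / 2) ^ (d' - T.card)
        = (M : ℝ) * (M : ℝ) ^ d' * ∑ T ∈ S.powerset, ((M : ℝ) ^ d')⁻¹ * ((((M : ℝ)) - 1) / 2) ^ T.card * ((((M : ℝ)) + 1) / 2) ^ (d' - T.card) := by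
          rw [Finset.mul_sum]
          refine Finset.sum_congr rfl fun T _ => ?_
          field_simp
      _ = (M : ℝ) ^ (d' + 1) := by rw [hW, mul_one, pow_succ, mul_comm]
  have hg0 : 0 ≤ ∑ y ∈ periodBox (d := d) N, g y := Finset.sum_nonneg fun y _ => by rw [hg]; positivity
  calc ∑ z ∈ periodBox (d := d) (M * N), ‖interp M S G z‖ ^ 2
      ≤ ∑ z ∈ periodBox (d := d) (M * N), interpCore S g (blk M z) (wt M z) := Finset.sum_le_sum fun z _ => hpt z
    _ = ∑ y ∈ periodBox (d := d) N, ∑ T ∈ S.powerset,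
          ((M : ℝ) * ((((M : ℝ)) - 1) / 2) ^ T.card * ((((M : ℝ)) + 1) / 2) ^ (S.card - T.card)) * g (y + indic T) := by
        rw [hblocks]; exact Finset.sum_congr rfl fun y _ => hfub y
    _ = ∑ T ∈ S.powerset, ((M : ℝ) * ((((M : ℝ)) - 1) / 2) ^ T.card * ((((M : ℝ)) + 1) / 2) ^ (S.card - T.card)) * ∑ y ∈ periodBox (d := d) N, g y := by
        rw [Finset.sum_comm]
        refine Finset.sum_congr rfl fun T _ => ?_
        rw [← Finset.mul_sum, hshift T]
    _ = (M : ℝ) ^ d * ∑ y ∈ periodBox (d := d) N, g y := by rw [← Finset.sum_mul, hweights]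

end Jensen

/-! ## §3 The Whitney-type lift: skewness, periodicity, sharp mass, gauge and curl commutation, curl energy -/

omit [Fintype n] [DecidableEq n] in
/-- The lift of a skew coarse field is skew. [folklore] -/
theorem isSkewDir_whitneyLift (M : ℕ) {φ : Site d → Fin d → Matrix n n ℂ} (hφ : IsSkewDir φ) :
    IsSkewDir (fun z κ => ((M : ℝ)⁻¹) • interp M (Finset.univ.erase κ) (fun y => φ y κ) z) := fun z κ =>
  skewAdjoint.smul_mem _ (interp_mem (skewAdjoint (Matrix n n ℂ)) (fun r _ hX => skewAdjoint.smul_mem r hX) _ _ (fun w => hφ w κ) z)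

omit [Fintype n] [DecidableEq n] in
/-- The lift of an `N`-periodic coarse field is `(M·N)`-periodic (`M ≥ 1`). [folklore] -/
theorem whitneyLift_add_period {M : ℕ} (hM : 1 ≤ M) {N : ℕ} {φ : Site d → Fin d → Matrix n n ℂ}
    (hφ : ∀ (z : Site d) (τ κ : Fin d), φ (z + (N : ℤ) • e τ) κ = φ z κ) (x : Site d) (τ κ : Fin d) :
    (fun z κ' => ((M : ℝ)⁻¹) • interp M (Finset.univ.erase κ') (fun y => φ y κ') z) (x + ((M * N : ℕ) : ℤ) • e τ) κ
      = (fun z κ' => ((M : ℝ)⁻¹) • interp M (Finset.univ.erase κ') (fun y => φ y κ') z) x κ := by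
  show ((M : ℝ)⁻¹) • interp M (Finset.univ.erase κ) (fun y => φ y κ) (x + ((M * N : ℕ) : ℤ) • e τ) = ((M : ℝ)⁻¹) • interp M (Finset.univ.erase κ) (fun y => φ y κ) x
  rw [interp_add_period hM (Finset.univ.erase κ) (fun z τ' => hφ z τ' κ) x τ]

/-- **(L1) THE SHARP MASS OF THE LIFT**: `dirSq (Wφ) [0,MN)^d ≤ (M^d∕M²)·dirSq φ [0,N)^d` for an `N`-periodic coarse 1-form (`M, N ≥ 1`) — constant ONE in front of the scale factor
`M^{d−2}` (a constant datum is lifted to the constant fine field `φ∕M`, on which equality holds). [folklore] -/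
theorem dirSq_whitneyLift_le {M : ℕ} (hM : 1 ≤ M) {N : ℕ} (hN : 1 ≤ N) {φ : Site d → Fin d → Matrix n n ℂ}
    (hφ : ∀ (z : Site d) (τ κ : Fin d), φ (z + (N : ℤ) • e τ) κ = φ z κ) :
    dirSq (fun z κ => ((M : ℝ)⁻¹) • interp M (Finset.univ.erase κ) (fun y => φ y κ) z) (periodBox (d := d) (M * N))
      ≤ (M : ℝ) ^ d / (M : ℝ) ^ 2 * dirSq φ (periodBox (d := d) N) := by
  have hM0 : (0 : ℝ) < M := by exact_mod_cast (by omega : 0 < M)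
  -- one component at a time
  have hκ : ∀ κ : Fin d, ∑ z ∈ periodBox (d := d) (M * N), ‖((M : ℝ)⁻¹) • interp M (Finset.univ.erase κ) (fun y => φ y κ) z‖ ^ 2
      ≤ (M : ℝ) ^ d / (M : ℝ) ^ 2 * ∑ y ∈ periodBox (d := d) N, ‖φ y κ‖ ^ 2 := by
    intro κ
    have h := sum_norm_sq_interp_le (X := Matrix n n ℂ) hM hN κ (G := fun y => φ y κ) (fun y τ => hφ y τ κ)
    have hsc : ∀ z : Site d, ‖((M : ℝ)⁻¹) • interp M (Finset.univ.erase κ) (fun y => φ y κ) z‖ ^ 2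
        = ((M : ℝ) ^ 2)⁻¹ * ‖interp M (Finset.univ.erase κ) (fun y => φ y κ) z‖ ^ 2 := by
      intro z
      rw [norm_smul, norm_inv, Real.norm_of_nonneg hM0.le, mul_pow, inv_pow]
    simp only [hsc]
    rw [← Finset.mul_sum]
    calc ((M : ℝ) ^ 2)⁻¹ * ∑ z ∈ periodBox (d := d) (M * N), ‖interp M (Finset.univ.erase κ) (fun y => φ y κ) z‖ ^ 2
        ≤ ((M : ℝ) ^ 2)⁻¹ * ((M : ℝ) ^ d * ∑ y ∈ periodBox (d := d) N, ‖φ y κ‖ ^ 2) := mul_le_mul_of_nonneg_left h (by positivity)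
      _ = (M : ℝ) ^ d / (M : ℝ) ^ 2 * ∑ y ∈ periodBox (d := d) N, ‖φ y κ‖ ^ 2 := by ring
  unfold dirSq
  calc ∑ z ∈ periodBox (d := d) (M * N), ∑ κ : Fin d, ‖((M : ℝ)⁻¹) • interp M (Finset.univ.erase κ) (fun y => φ y κ) z‖ ^ 2
      = ∑ κ : Fin d, ∑ z ∈ periodBox (d := d) (M * N), ‖((M : ℝ)⁻¹) • interp M (Finset.univ.erase κ) (fun y => φ y κ) z‖ ^ 2 := Finset.sum_comm
    _ ≤ ∑ κ : Fin d, (M : ℝ) ^ d / (M : ℝ) ^ 2 * ∑ y ∈ periodBox (d := d) N, ‖φ y κ‖ ^ 2 := Finset.sum_le_sum fun κ _ => hκ κ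
    _ = (M : ℝ) ^ d / (M : ℝ) ^ 2 * ∑ y ∈ periodBox (d := d) N, ∑ κ : Fin d, ‖φ y κ‖ ^ 2 := by rw [← Finset.mul_sum, Finset.sum_comm]

/-- The flat gauge direction, explicitly: `gaugeDir 1 ν (x, μ) = ν x − ν (x + e_μ)`. [folklore] -/
theorem gaugeDir_flat_apply (ν : Site d → Matrix n n ℂ) (x : Site d) (μ : Fin d) :
    gaugeDir (flat (d := d) (n := n)) ν x μ = ν x - ν (x + e μ) := by
  simp only [gaugeDir, Ad, BlockAveragePushDirSplit.flat, Units.val_one, inv_one, one_mul, mul_one]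

/-- **GAUGE DIRECTIONS LIFT TO GAUGE DIRECTIONS OF THE NODAL INTERPOLANT** (`M ≥ 1`): `W (gaugeDir 1 ν) = gaugeDir 1 (interp M univ ν)` — EXACT (the difference formula
✓ `interp_add_e_of_mem` of the multilinear interpolant). [folklore] -/
theorem whitneyLift_gaugeDir_flat {M : ℕ} (hM : 1 ≤ M) (ν : Site d → Matrix n n ℂ) (z : Site d) (κ : Fin d) :
    ((M : ℝ)⁻¹) • interp M (Finset.univ.erase κ) (fun y => gaugeDir (flat (d := d) (n := n)) ν y κ) z
      = gaugeDir (flat (d := d) (n := n)) (interp M Finset.univ ν) z κ := by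
  rw [gaugeDir_flat_apply]
  have hfd := interp_add_e_of_mem (X := Matrix n n ℂ) hM (Finset.mem_univ κ) ν z
  -- `interp univ ν (z+e_κ) − interp univ ν z = (1/M) • interp (univ∖κ) (cfd κ ν) z`
  have hcfd : (fun y => gaugeDir (flat (d := d) (n := n)) ν y κ) = fun y => -(cfd κ ν y) := by
    funext y; rw [gaugeDir_flat_apply]; simp [cfd]
  rw [hcfd]
  have hneg : interp M (Finset.univ.erase κ) (fun y => -cfd κ ν y) z = -interp M (Finset.univ.erase κ) (cfd κ ν) z := by
    have := interp_sub (X := Matrix n n ℂ) M (Finset.univ.erase κ) (fun _ => (0 : Matrix n n ℂ)) (cfd κ ν) z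
    simp only [zero_sub] at this
    rw [this]
    have h0 : interp M (Finset.univ.erase κ) (fun _ : Site d => (0 : Matrix n n ℂ)) z = 0 :=
      SmoothRefineInterp.interpCore_const _ _ _ _
    rw [h0, zero_sub]
  rw [hneg, smul_neg, ← one_div, ← hfd]
  abel

/-- The flat curl of a coarse 1-form as a difference of coarse forward differences: `curl_1 φ (y; μ, ν) = (∇_μ φ_ν)(y) − (∇_ν φ_μ)(y)`. [folklore] -/
theorem curlAt_flat_eq_cfd (φ : Site d → Fin d → Matrix n n ℂ) (y : Site d) (μ ν : Fin d) :
    curlAt (flat (d := d) (n := n)) φ y μ ν = cfd μ (fun w => φ w ν) y - cfd ν (fun w => φ w μ) y := by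
  rw [curlAt_flat_eq]; rfl

/-- **THE EXACT WHITNEY ∕ DE RHAM COMMUTATION** (`M ≥ 1`, `μ ≠ ν`): `curl_1 (Wφ) (z; μ, ν) = M^{−2} • interp M ((univ∖{μ})∖{ν}) (curl_1 φ (·; μ, ν)) z` — the flat curl of the lift is
`M^{−2}` times the `(d−2)`-linear transverse interpolant of the COARSE flat curl: a curl-free datum lifts curl-free. [folklore] -/
theorem curlAt_flat_whitneyLift {M : ℕ} (hM : 1 ≤ M) (φ : Site d → Fin d → Matrix n n ℂ) (z : Site d) {μ ν : Fin d} (hμν : μ ≠ ν) :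
    curlAt (flat (d := d) (n := n)) (fun x κ => ((M : ℝ)⁻¹) • interp M (Finset.univ.erase κ) (fun y => φ y κ) x) z μ ν
      = (((M : ℝ) ^ 2)⁻¹) • interp M ((Finset.univ.erase μ).erase ν) (fun y => curlAt (flat (d := d) (n := n)) φ y μ ν) z := by
  have hM0 : (M : ℝ) ≠ 0 := by exact_mod_cast (by omega : M ≠ 0)
  rw [curlAt_flat_eq]
  -- the two transverse steps of the lift
  have hμ : μ ∈ Finset.univ.erase ν := Finset.mem_erase.mpr ⟨hμν, Finset.mem_univ μ⟩
  have hν : ν ∈ Finset.univ.erase μ := Finset.mem_erase.mpr ⟨fun h => hμν h.symm, Finset.mem_univ ν⟩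
  have h1 := interp_add_e_of_mem (X := Matrix n n ℂ) hM hμ (fun y => φ y ν) z
  have h2 := interp_add_e_of_mem (X := Matrix n n ℂ) hM hν (fun y => φ y μ) z
  have hS : (Finset.univ.erase ν).erase μ = (Finset.univ.erase μ).erase ν := Finset.erase_right_comm
  rw [hS] at h1
  -- the curl datum is the difference of the two forward differences
  have hc : (fun y => curlAt (flat (d := d) (n := n)) φ y μ ν) = fun y => cfd μ (fun w => φ w ν) y - cfd ν (fun w => φ w μ) y := by
    funext y; exact curlAt_flat_eq_cfd φ y μ ν
  rw [hc, interp_sub]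
  -- assemble
  have e1 : ((M : ℝ)⁻¹) • interp M (Finset.univ.erase ν) (fun y => φ y ν) (z + e μ) - ((M : ℝ)⁻¹) • interp M (Finset.univ.erase ν) (fun y => φ y ν) z
      = ((M : ℝ)⁻¹) • ((1 / (M : ℝ)) • interp M ((Finset.univ.erase μ).erase ν) (cfd μ fun y => φ y ν) z) := by
    rw [← smul_sub, h1]
  have e2 : ((M : ℝ)⁻¹) • interp M (Finset.univ.erase μ) (fun y => φ y μ) (z + e ν) - ((M : ℝ)⁻¹) • interp M (Finset.univ.erase μ) (fun y => φ y μ) z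
      = ((M : ℝ)⁻¹) • ((1 / (M : ℝ)) • interp M ((Finset.univ.erase μ).erase ν) (cfd ν fun y => φ y μ) z) := by
    rw [← smul_sub, h2]
  rw [e1, e2, smul_smul, smul_smul, ← smul_sub]
  congr 1
  rw [one_div, ← pow_two, inv_pow]

/-- **(L2) THE CURL ENERGY OF THE LIFT AGAINST THE COARSE CURL ENERGY** (`M, N ≥ 1`, `μ ≠ ν`, `φ` `N`-periodic):
`Σ_{z∈[0,MN)^d} ‖curl_1 (Wφ)(z;μ,ν)‖² ≤ 2^{d−2}·(M^d∕M⁴)·Σ_{y∈[0,N)^d} ‖curl_1 φ (y;μ,ν)‖²` — no mass, no gradient of the datum: the curl channel of the memo's recursion. [folklore] -/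
theorem sum_norm_sq_curlAt_flat_whitneyLift_le {M : ℕ} (hM : 1 ≤ M) {N : ℕ} (hN : 1 ≤ N) {φ : Site d → Fin d → Matrix n n ℂ}
    (hφ : ∀ (z : Site d) (τ κ : Fin d), φ (z + (N : ℤ) • e τ) κ = φ z κ) {μ ν : Fin d} (hμν : μ ≠ ν) :
    ∑ z ∈ periodBox (d := d) (M * N), ‖curlAt (flat (d := d) (n := n)) (fun x κ => ((M : ℝ)⁻¹) • interp M (Finset.univ.erase κ) (fun y => φ y κ) x) z μ ν‖ ^ 2
      ≤ 2 ^ (d - 2) * ((M : ℝ) ^ d / (M : ℝ) ^ 4) * ∑ y ∈ periodBox (d := d) N, ‖curlAt (flat (d := d) (n := n)) φ y μ ν‖ ^ 2 := by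
  have hM0 : (0 : ℝ) < M := by exact_mod_cast (by omega : 0 < M)
  set S : Finset (Fin d) := (Finset.univ.erase μ).erase ν with hS
  set g : Site d → ℝ := fun y => ‖curlAt (flat (d := d) (n := n)) φ y μ ν‖ ^ 2 with hg
  have hg0 : ∀ y, 0 ≤ g y := fun y => by rw [hg]; positivity
  -- periodicity of the coarse curl density
  have hgP : ∀ (x : Site d) (τ : Fin d), g (x + (N : ℤ) • e τ) = g x := by
    intro x τ
    simp only [hg, curlAt_flat_eq, add_right_comm _ ((N : ℤ) • e τ), hφ]
  -- pointwise: exact commutation + Jensen + crude corner sum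
  have hpt : ∀ z : Site d,
      ‖curlAt (flat (d := d) (n := n)) (fun x κ => ((M : ℝ)⁻¹) • interp M (Finset.univ.erase κ) (fun y => φ y κ) x) z μ ν‖ ^ 2
        ≤ ((M : ℝ) ^ 4)⁻¹ * ∑ T ∈ S.powerset, g (blk M z + indic T) := by
    intro z
    rw [curlAt_flat_whitneyLift hM φ z hμν, norm_smul, norm_inv, Real.norm_of_nonneg (by positivity), mul_pow, inv_pow, ← pow_mul]
    refine mul_le_mul_of_nonneg_left ?_ (by positivity)
    refine (norm_sq_interpCore_le S (wt_nonneg hM z) (wt_le_one hM z) _ (blk M z)).trans ?_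
    exact interpCore_real_le_sum S (wt_nonneg hM z) (wt_le_one hM z) hg0 (blk M z)
  -- block decomposition: the summand depends on `z` only through `blk M z`
  have hblocks : ∑ z ∈ periodBox (d := d) (M * N), ∑ T ∈ S.powerset, g (blk M z + indic T)
      = (M : ℝ) ^ d * ∑ y ∈ periodBox (d := d) N, ∑ T ∈ S.powerset, g (y + indic T) := by
    rw [← blockSites_periodBox M N hM, ← sum_blocks_eq M hM, Finset.mul_sum]
    refine Finset.sum_congr rfl fun y _ => ?_
    rw [Finset.sum_congr rfl fun r _ => by rw [blk_boxVec hM y r], Finset.sum_const, Finset.card_univ, nsmul_eq_mul]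
    congr 1
    rw [Fintype.card_pi, Finset.prod_const, Fintype.card_fin, Finset.card_univ, Fintype.card_fin]
    push_cast; ring
  -- corner shifts: `2^{|S|}` copies of the coarse curl energy
  have hcorner : ∑ y ∈ periodBox (d := d) N, ∑ T ∈ S.powerset, g (y + indic T) = 2 ^ (d - 2) * ∑ y ∈ periodBox (d := d) N, g y := by
    rw [Finset.sum_comm, Finset.sum_congr rfl fun T _ => sum_periodBox_shift N hN hgP (indic T), Finset.sum_const, Finset.card_powerset, nsmul_eq_mul]
    congr 1
    rw [hS, Finset.card_erase_of_mem (Finset.mem_erase.mpr ⟨fun h => hμν h.symm, Finset.mem_univ ν⟩), Finset.card_erase_of_mem (Finset.mem_univ μ),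
      Finset.card_univ, Fintype.card_fin]
    push_cast
    congr 1
  calc ∑ z ∈ periodBox (d := d) (M * N), ‖curlAt (flat (d := d) (n := n)) (fun x κ => ((M : ℝ)⁻¹) • interp M (Finset.univ.erase κ) (fun y => φ y κ) x) z μ ν‖ ^ 2
      ≤ ∑ z ∈ periodBox (d := d) (M * N), ((M : ℝ) ^ 4)⁻¹ * ∑ T ∈ S.powerset, g (blk M z + indic T) := Finset.sum_le_sum fun z _ => hpt z
    _ = ((M : ℝ) ^ 4)⁻¹ * ((M : ℝ) ^ d * (2 ^ (d - 2) * ∑ y ∈ periodBox (d := d) N, g y)) := by rw [← Finset.mul_sum, hblocks, hcorner]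
    _ = 2 ^ (d - 2) * ((M : ℝ) ^ d / (M : ℝ) ^ 4) * ∑ y ∈ periodBox (d := d) N, g y := by ring

end

end Summit.QuantumFields.BalabanUV.T4Continuum.NE7WhitneyLiftFlat
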